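import Summits.BirchSwinnertonDyer.BirchSwinnertonDyer.Theorems.KatoDescentPotSupersingularUnitIndexMuDoorsFukudaAt
import Summits.BirchSwinnertonDyer.BirchSwinnertonDyer.Theorems.KatoDescentPotSupersingularWildConjAResidueCartanRows03
import Summits.BirchSwinnertonDyer.BirchSwinnertonDyer.Theorems.KatoDescentPotSupersingularWildConjAResidueCartanRows04
import HarnessLib

/-!
# Route `KatoDescentPotSupersingular` (rung K9, sub-rung B5 = O6 wild `p = 3`, cell `bsd-potss`): `3Ns` RESIDUE ROWS of the Conj-A crux
# `WildCoatesSujathaResidue` (19942; U₀-ns node 19189 → parent 19197 `WildUpperDefectRankZero`) whose maximal real subfield `K⁺ = ℚ(E[3])⁺`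
# GROWS at layers `(0,1)` and SETTLES at `(1,2)` — (A) / U₀ per row with the classical `μ`-hypothesis DISCHARGED modulo Fukuda 1994 Thm. 1
# from displayed, PARI-computed layer data (part 03: 261360he1, 261360iv1)
# (seat `bsd-potss-k9-c4` g19; `--supports stmt-BirchSwinnertonDyer-19197 --as helper`)

HONEST FRAMING. THEOREMS ONLY (no definition, no named fact, no `sorry`); PER ROW — NOT a class theorem; nothing is booked; items 19942 / 19189
/ 19197 stay OPEN at class level (open input: the zeta crux 24327 `WildKatoZetaIndivisible`); Coates–Sujatha's (A), Conjecture A and BSD are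
proved for NO curve here.  g18's records on these rows (`…WildConjAResidueCartanRows01–05`) DISPLAY `hμ` («`μ = 0` for the cyclotomic
`ℤ_3`-extension of `K⁺`»).  THIS FILE replaces `hμ` by Fukuda's criterion at layers `(1, 2)` of the cyclotomic `ℤ_3`-tower of `K⁺` (doors
`UnitIndexMuDoors.…_of_realSuccEqAt` / `…_of_realRankSuccEqAt`, this seat): displayed per row = Fukuda index `0` (`hram`: both primes of `K⁺` above
`3` have `e·f = 2`, prime to `3` — exact) and the equality of consecutive layer invariants (`hord` / `hrk`).  NUMERICS (kit j308602, `--workitem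
19197`, PARI/GP 2.17; `K⁺_n = K⁺·ℚ_n`, `ℚ_n ⊂ ℚ(ζ_{3^{n+1}})` of degree `3^n`): `ℚ[x]/(x⁴+22x²−11)` (rows 261360he1, 261360iv1): `h = 2 → 6 → 18`, cyclic `[18]`, so `e = 0, 1, 2` but `rank₃ = 0, 1, 1` ⟹ Thm. 1 (2) at `(1,2)` (the class-number form does NOT apply: `e` still grows).
Layer `0` and `1` class numbers CERTIFIED (`bnfcertify`), layer `2` (degree 36) under GRH — said in each docstring.  KERNEL per row (g18,
imported): `Δ ≠ 0`, minimality, `E[3]` irreducible, `ClassO6 E 3`, the `3Ns` image.  Data: HOME/k9-c4/g19/.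

References: [Fukuda1994] Thm. 1 (1), (2); [CoatesSujatha2005] Thm. 3.4; [Kato2004Asterisque] Thm. 14.5 (3); [Serre1972] §2.2, §5.2; [Cremona2006] Table 1.
-/

set_option autoImplicit false
set_option linter.dupNamespace false

noncomputable section

open scoped Classical NumberField
open WeierstrassCurve NumberField IsDedekindDomain Field IntermediateField
  Literature.NumberTheory.EllipticCurves Literature.NumberTheory.EllipticCurves.Rank1Residual
  Literature.NumberTheory.EllipticCurves.Rank1Residual.Typed
  Literature.NumberTheory.GaloisRepresentations Literature.NumberTheory.SerreUniformity Literature.NumberTheory.IwasawaTheory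
  Summit.BirchSwinnertonDyer.Rank1Residual Summit.BirchSwinnertonDyer.Rank1Residual.Additive
  Summit.BirchSwinnertonDyer.BirchSwinnertonDyer.Theorems

namespace Summit.BirchSwinnertonDyer.BirchSwinnertonDyer.Theorems.WildUpperUnitTwistRecords

/-! ### `261360he1` @ `p = 3` (`3Ns`; `K⁺ = ℚ[x]/(x⁴ + 22x² − 11)`: `h = 2, 6, 18` at layers `0, 1, 2` (CERT, CERT, GRH), `e = 0, 1, 2` but `3`-rank `0, 1, 1`) -/

set_option synthInstance.maxHeartbeats 400000 in
set_option maxHeartbeats 4000000 in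
/-- **(A) AT `(261360he1, 3)` with `hμ` DISCHARGED by FUKUDA Thm. 1 (2) (`3`-RANKS) at layers `(1,2)` (`rank₁ = rank₂`)** (modulo `hCS`, `hFW`, `hF2`): `c` a complex conjugation, `Kp = ℚ(E[3])^c`
(`hKp`; `K⁺ = ℚ[x]/(x⁴ + 22x² − 11)`: `h = 2, 6, 18` at layers `0, 1, 2` (CERT, CERT, GRH), `e = 0, 1, 2` but `3`-rank `0, 1, 1`), displayed numerics: Fukuda index `0` (`hram`, exact) and `hrk` (layer `1` certified, layer `2` under GRH; kit j308602).
KERNEL: the `3Ns` image (g18). CONDITIONAL; nothing booked; (A)/BSD proved for no curve. [cite: Fukuda1994, Thm. 1 (2), p. 264] [cite: CoatesSujatha2005, Thm. 3.4 (§3)]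
[cite: Cremona2006, Table 1 (Cremona label 261360he1)] -/
theorem conjA_g261360he1_3_fr12
    (hCS : CoatesSujatha2005.thm34_fineSelmerDual_moduleFinite_of_classicalMuVanishes_divisionField)
    (hFW : ferreroWashington1979_classicalMuVanishes) (hF2 : fukuda1994_thm1_classGroupPRank_const_of_succ_eq)
    {W : WeierstrassCurve ℚ} [W.IsElliptic] (hWeq : W = (⟨0, 0, 0, 22604373, (-9557732646)⟩ : WeierstrassCurve ℚ))
    {c : absoluteGaloisGroup ℚ} (hc : IsComplexConjugation (Rat.castHom ℝ) c)
    (Kp : IntermediateField ℚ ↥(W.divisionField 3)) (hKp : Kp = fixedField (Subgroup.zpowers (absRestrictNormalHom (W.divisionField 3) c)))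
    (hram : ∀ κE : ZpExtension ↥Kp 3, κE.IsCyclotomic → TotallyRamifiedFrom κE 0)
    (hrk : ∀ κE : ZpExtension ↥Kp 3, κE.IsCyclotomic → classGroupPRank κE (1 + 1) = classGroupPRank κE 1)
    (κ : ZpExtension ℚ 3) (hκ : κ.IsCyclotomic) :
    ∃ (γ : absoluteGaloisGroup ℚ) (Df : W.FineSelmerDualData κ γ),
      Module.Finite ℤ_[3] (RestrictScalars ℤ_[3] (IwasawaAlgebra 3) Df.X) := by
  subst hWeq
  exact UnitIndexMuDoors.conjA_three_of_hasSplitCartanNormalizerModPImage_of_realRankSuccEqAt _ hCS hFW hF2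
    hasSplitCartanNormalizerModPImage_g261360he1_3 hc Kp hKp 1 hram hrk κ hκ

set_option synthInstance.maxHeartbeats 400000 in
set_option maxHeartbeats 4000000 in
/-- **RECORD — U₀ `ord₃ #Ш(E) ≤ ord₃ #Ш_an(E)` for `E = 261360he1` with `hμ` DISCHARGED by FUKUDA Thm. 1 (2) (`3`-RANKS) at layers `(1,2)` (`rank₁ = rank₂`)**: named facts {A161-fine `hKatoA`, GZK `hGZK`,
modularity `hmod`, `hCS`, `hFW`, `hF2`}, Cremona's `r_an = 0` (`hr`), and the displayed layer data `hram` / `hrk` of `Kp = ℚ(E[3])^c` (`K⁺ = ℚ[x]/(x⁴ + 22x² − 11)`: `h = 2, 6, 18` at layers `0, 1, 2` (CERT, CERT, GRH), `e = 0, 1, 2` but `3`-rank `0, 1, 1`;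
kit j308602). KERNEL (g18): elliptic, minimal, `ClassO6 E 3`, `E[3]` irreducible, `3Ns` image. Supersedes the displayed-`hμ` record
`missingUpperBoundAt_g261360he1_3`. Per row; nothing booked; BSD proved for no curve. [cite: Kato2004Asterisque, Thm. 14.5 (3) (p. 236)] [cite: Fukuda1994, Thm. 1 (2), p. 264]
[cite: Cremona2006, Table 1 (Cremona label 261360he1)] -/
theorem missingUpperBoundAt_g261360he1_3_fr12
    (hKatoA : Kato2004.rankZero_padicValNat_sha_add_padicValNat_tamagawa_le_of_additive_potGood_of_irreducible_of_fineSelmerDual_fg)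
    (hGZK : rank_eq_analyticRank_of_analyticRank_le_one) (hmod : hasEntireLFunction_rat)
    (hCS : CoatesSujatha2005.thm34_fineSelmerDual_moduleFinite_of_classicalMuVanishes_divisionField)
    (hFW : ferreroWashington1979_classicalMuVanishes) (hF2 : fukuda1994_thm1_classGroupPRank_const_of_succ_eq)
    {W : WeierstrassCurve ℚ} [W.IsElliptic] [W.IsGloballyMinimal] (hWeq : W = (⟨0, 0, 0, 22604373, (-9557732646)⟩ : WeierstrassCurve ℚ)) (hr : W.analyticRank = 0)
    {c : absoluteGaloisGroup ℚ} (hc : IsComplexConjugation (Rat.castHom ℝ) c)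
    (Kp : IntermediateField ℚ ↥(W.divisionField 3)) (hKp : Kp = fixedField (Subgroup.zpowers (absRestrictNormalHom (W.divisionField 3) c)))
    (hram : ∀ κE : ZpExtension ↥Kp 3, κE.IsCyclotomic → TotallyRamifiedFrom κE 0)
    (hrk : ∀ κE : ZpExtension ↥Kp 3, κE.IsCyclotomic → classGroupPRank κE (1 + 1) = classGroupPRank κE 1) :
    MissingUpperBoundAt W 3 := by
  subst hWeq
  haveI : Fact (Nat.Prime 3) := ⟨Nat.prime_three⟩
  exact UnitIndexMuDoors.missingUpperBoundAt_three_of_hasSplitCartanNormalizerModPImage_of_realRankSuccEqAt _ hKatoA hGZK hmod hCS hFW hF2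
    hr classO6_g261360he1_3 irr_g261360he1_3 hasSplitCartanNormalizerModPImage_g261360he1_3 hc Kp hKp 1 hram hrk

/-! ### `261360iv1` @ `p = 3` (`3Ns`; `K⁺ = ℚ[x]/(x⁴ + 22x² − 11)`: `h = 2, 6, 18` at layers `0, 1, 2` (CERT, CERT, GRH), `e = 0, 1, 2` but `3`-rank `0, 1, 1`) -/

set_option synthInstance.maxHeartbeats 400000 in
set_option maxHeartbeats 4000000 in
/-- **(A) AT `(261360iv1, 3)` with `hμ` DISCHARGED by FUKUDA Thm. 1 (2) (`3`-RANKS) at layers `(1,2)` (`rank₁ = rank₂`)** (modulo `hCS`, `hFW`, `hF2`): `c` a complex conjugation, `Kp = ℚ(E[3])^c`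
(`hKp`; `K⁺ = ℚ[x]/(x⁴ + 22x² − 11)`: `h = 2, 6, 18` at layers `0, 1, 2` (CERT, CERT, GRH), `e = 0, 1, 2` but `3`-rank `0, 1, 1`), displayed numerics: Fukuda index `0` (`hram`, exact) and `hrk` (layer `1` certified, layer `2` under GRH; kit j308602).
KERNEL: the `3Ns` image (g18). CONDITIONAL; nothing booked; (A)/BSD proved for no curve. [cite: Fukuda1994, Thm. 1 (2), p. 264] [cite: CoatesSujatha2005, Thm. 3.4 (§3)]
[cite: Cremona2006, Table 1 (Cremona label 261360iv1)] -/
theorem conjA_g261360iv1_3_fr12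
    (hCS : CoatesSujatha2005.thm34_fineSelmerDual_moduleFinite_of_classicalMuVanishes_divisionField)
    (hFW : ferreroWashington1979_classicalMuVanishes) (hF2 : fukuda1994_thm1_classGroupPRank_const_of_succ_eq)
    {W : WeierstrassCurve ℚ} [W.IsElliptic] (hWeq : W = (⟨0, 0, 0, (-1832787), (-687043566)⟩ : WeierstrassCurve ℚ))
    {c : absoluteGaloisGroup ℚ} (hc : IsComplexConjugation (Rat.castHom ℝ) c)
    (Kp : IntermediateField ℚ ↥(W.divisionField 3)) (hKp : Kp = fixedField (Subgroup.zpowers (absRestrictNormalHom (W.divisionField 3) c)))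
    (hram : ∀ κE : ZpExtension ↥Kp 3, κE.IsCyclotomic → TotallyRamifiedFrom κE 0)
    (hrk : ∀ κE : ZpExtension ↥Kp 3, κE.IsCyclotomic → classGroupPRank κE (1 + 1) = classGroupPRank κE 1)
    (κ : ZpExtension ℚ 3) (hκ : κ.IsCyclotomic) :
    ∃ (γ : absoluteGaloisGroup ℚ) (Df : W.FineSelmerDualData κ γ),
      Module.Finite ℤ_[3] (RestrictScalars ℤ_[3] (IwasawaAlgebra 3) Df.X) := by
  subst hWeq
  exact UnitIndexMuDoors.conjA_three_of_hasSplitCartanNormalizerModPImage_of_realRankSuccEqAt _ hCS hFW hF2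
    hasSplitCartanNormalizerModPImage_g261360iv1_3 hc Kp hKp 1 hram hrk κ hκ

set_option synthInstance.maxHeartbeats 400000 in
set_option maxHeartbeats 4000000 in
/-- **RECORD — U₀ `ord₃ #Ш(E) ≤ ord₃ #Ш_an(E)` for `E = 261360iv1` with `hμ` DISCHARGED by FUKUDA Thm. 1 (2) (`3`-RANKS) at layers `(1,2)` (`rank₁ = rank₂`)**: named facts {A161-fine `hKatoA`, GZK `hGZK`,
modularity `hmod`, `hCS`, `hFW`, `hF2`}, Cremona's `r_an = 0` (`hr`), and the displayed layer data `hram` / `hrk` of `Kp = ℚ(E[3])^c` (`K⁺ = ℚ[x]/(x⁴ + 22x² − 11)`: `h = 2, 6, 18` at layers `0, 1, 2` (CERT, CERT, GRH), `e = 0, 1, 2` but `3`-rank `0, 1, 1`;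
kit j308602). KERNEL (g18): elliptic, minimal, `ClassO6 E 3`, `E[3]` irreducible, `3Ns` image. Supersedes the displayed-`hμ` record
`missingUpperBoundAt_g261360iv1_3`. Per row; nothing booked; BSD proved for no curve. [cite: Kato2004Asterisque, Thm. 14.5 (3) (p. 236)] [cite: Fukuda1994, Thm. 1 (2), p. 264]
[cite: Cremona2006, Table 1 (Cremona label 261360iv1)] -/
theorem missingUpperBoundAt_g261360iv1_3_fr12
    (hKatoA : Kato2004.rankZero_padicValNat_sha_add_padicValNat_tamagawa_le_of_additive_potGood_of_irreducible_of_fineSelmerDual_fg)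
    (hGZK : rank_eq_analyticRank_of_analyticRank_le_one) (hmod : hasEntireLFunction_rat)
    (hCS : CoatesSujatha2005.thm34_fineSelmerDual_moduleFinite_of_classicalMuVanishes_divisionField)
    (hFW : ferreroWashington1979_classicalMuVanishes) (hF2 : fukuda1994_thm1_classGroupPRank_const_of_succ_eq)
    {W : WeierstrassCurve ℚ} [W.IsElliptic] [W.IsGloballyMinimal] (hWeq : W = (⟨0, 0, 0, (-1832787), (-687043566)⟩ : WeierstrassCurve ℚ)) (hr : W.analyticRank = 0)
    {c : absoluteGaloisGroup ℚ} (hc : IsComplexConjugation (Rat.castHom ℝ) c)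
    (Kp : IntermediateField ℚ ↥(W.divisionField 3)) (hKp : Kp = fixedField (Subgroup.zpowers (absRestrictNormalHom (W.divisionField 3) c)))
    (hram : ∀ κE : ZpExtension ↥Kp 3, κE.IsCyclotomic → TotallyRamifiedFrom κE 0)
    (hrk : ∀ κE : ZpExtension ↥Kp 3, κE.IsCyclotomic → classGroupPRank κE (1 + 1) = classGroupPRank κE 1) :
    MissingUpperBoundAt W 3 := by
  subst hWeq
  haveI : Fact (Nat.Prime 3) := ⟨Nat.prime_three⟩
  exact UnitIndexMuDoors.missingUpperBoundAt_three_of_hasSplitCartanNormalizerModPImage_of_realRankSuccEqAt _ hKatoA hGZK hmod hCS hFW hF2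
    hr classO6_g261360iv1_3 irr_g261360iv1_3 hasSplitCartanNormalizerModPImage_g261360iv1_3 hc Kp hKp 1 hram hrk

end Summit.BirchSwinnertonDyer.BirchSwinnertonDyer.Theorems.WildUpperUnitTwistRecords

end
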